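import Literature.NumberTheory.Rogawski1990.ArchSmoothAmbientLift                  -- ★ `ArchSmooth₂.exists_contDiff` (ambient `Θ` on `M₃(L ⊗ ℝ)`), ★ `endoEmbArch`, `coe_endoEmbArch`
import Literature.NumberTheory.Automorphic.ArchStableConjugacyLocalGlobal         -- ★ `coe_archPiEquivCM_apply` (the `w`-component is `GL₂(evalC w)`); brings `archPiEquivCM`, `mixedSpace_ext`
import Mathlib.Analysis.Normed.Module.FiniteDimension
import HarnessLib

/-!
# THE AMBIENT MATRIX OF `ι_∞(eA⁻¹ G, b)` IS AFFINE IN EACH PLACE BLOCK: replacing the `w₀`-component `G_{w₀}` by `Y` adds `Λ_{w₀}(↑↑Y − ↑↑G_{w₀})` for a fixed injective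
# `ℝ`-linear `Λ_{w₀} : M₂(ℂ) → M₃(L ⊗ ℝ)` (stage (α4-S2) of the transport of ★ (ELL-∞) to Bouaziz (I₂): the test-function family of a wall place; Rogawski 1990 §4.8, §8.2)

Topic `NumberTheory/Rogawski1990`; namespace `Literature.NumberTheory.Rogawski1990`.  THEOREMS ONLY (no `def`, no instance, no axiom, no `sorry`).  Cell `pub/hodgecm-mathlib`, crux H413
(`stmt-HodgeConjecture-24833`), line LH3 (closer stub `stub_N9`, DIRECT ROAD), organ O-L3′ conjunct (ii) pay-down for GENERAL `fH` (LH3-plan (g3) RULINGS #7 (d) ∕ #11), stage (α4-S2) of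
`F0/P3c/LH3/LH3-p01/g4/ALPHA4-DESIGN.v1.md`.  Author LH3-p01 (g4).  Count-neutral.

THE POINT.  ★ (α4-S3) `exists_forall_eventually_norm_iteratedDeriv_average_orbitalIntegral_cayley_le` wants the test-function family of a wall place `w₀` in the form `Φ(ι p, Y)` with
`Φ : Q × M₂(ℂ) → E` JOINTLY `C^∞` and `ι` continuous.  For `fH ∈ C_c^∞(H_∞)` with ambient lift `Θ` (★ `ArchSmooth₂.exists_contDiff`: `fH k = Θ(↑↑ι_∞(k))`, `Θ ∈ C_c^∞(M₃(L ⊗ ℝ))`) this is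
achieved with `Q := M₃(L ⊗ ℝ)` and `Φ(q, Y) := Θ(q + Λ_{w₀} Y)` as soon as the ambient matrix `↑↑ι_∞(eA⁻¹ G, b)` is AFFINE in the `w₀`-block `G_{w₀}` — which it is: `ι_∞ = endoGL` is the block
embedding `(g₂, u) ↦ (a 0 b; 0 u 0; c 0 d)` (additive in `g₂`), and the `(i,j)` entry of `↑↑(eA⁻¹ G)` is the element of `L ⊗ ℝ = Π_w ℂ` with `w`-coordinate `(G_w)_{ij}` (★ `coe_archPiEquivCM_apply`,
`mixedSpace_ext`).
* §1 **`exists_clm_ambient_endoEmbArch_update`**: `∃ Λ : M₂(ℂ) →L[ℝ] M₃(L ⊗ ℝ)` injective with, for all `G : Π_w U(Φ₂)_w`, `Y ∈ U(Φ₂)_{w₀}`, `b ∈ U(Φ₁)_∞`,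
  `↑↑ι_∞(eA⁻¹(update G w₀ Y), b) = ↑↑ι_∞(eA⁻¹ G, b) + Λ(↑↑Y − ↑↑G_{w₀})`.
* §2 **`exists_isCompact_forall_ne_zero_imp_mem`**: for `Θ` with compact support, `Λ` an injective linear map from a finite-dimensional space and a compact `C ⊆ Q`, ONE compact `K` with
  `Θ(q + Λ Y) ≠ 0 → Y ∈ K` for all `q ∈ C` (the uniform `Y`-support clause `h0` of ★ (α4-S3)); **`contDiff_comp_add_clm`**: `(q, Y) ↦ Θ(q + Λ Y)` is `C^∞`.
HONEST LABEL: HC_CM is proved only modulo the 7 printed citations (2 remaining: hLiu418 = stmt-HodgeConjecture-24832, h413 = stmt-HodgeConjecture-24833) until rung 0 closes; bookkeeping for the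
all-orders transport, pays nothing by itself.

## References
* [Rogawski1990] J. D. Rogawski, *Automorphic Representations of Unitary Groups in Three Variables*, Ann. of Math. Stud. 123 (1990), §4.8 Case (a) p. 53; §8.2 pp. 119–122.
* [BorelJacquet1979] A. Borel, H. Jacquet, *Automorphic forms and automorphic representations*, PSPM 33.1 (1979), §4.1 (the archimedean group as a product over the places).
* [HormanderALPDO1] L. Hörmander, *The Analysis of Linear Partial Differential Operators I* (1990), §1.1.
-/

set_option autoImplicit false

noncomputable section

open Set Function NumberField NumberField.InfinitePlace NumberField.mixedEmbedding Matrix Topology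
open Literature.NumberTheory.Automorphic Literature.NumberTheory.Automorphic.UnitaryGroup
open scoped MatrixGroups Matrix ContDiff Classical

namespace Literature.NumberTheory.Rogawski1990

local notation3 "Φ₂[" L "]" => (Matrix.of fun i j : Fin 2 => if i.val + j.val + 1 = 2 then (1 : L) else 0)
local notation3 "Φ₁[" L "]" => (Matrix.of fun i j : Fin 1 => if i.val + j.val + 1 = 1 then (1 : L) else 0)
local notation3 "𝔸[" L "]" => ↥(arch (↥(maximalRealSubfield L)) L (IsCMField.complexConj L) 2 Φ₂[L])
local notation3 "𝔹[" L "]" => ↥(arch (↥(maximalRealSubfield L)) L (IsCMField.complexConj L) 1 Φ₁[L])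

/-! ## §1 The place-update identity for the ambient matrix of `ι_∞(eA⁻¹ G, b)` -/

section Update

variable (L : Type) [Field L] [NumberField L] [IsCMField L] (w₀ : {w : InfinitePlace L // IsComplex w})

/-- **THE AMBIENT MATRIX OF `ι_∞(eA⁻¹ G, b)` IS AFFINE IN THE `w₀`-BLOCK**: there is an injective `ℝ`-linear `Λ : M₂(ℂ) →L[ℝ] M₃(L ⊗ ℝ)` (the `(i,j)`-entry of `Λ X`, `i, j ∈ {e₁, e₃}`, is the
element of `L ⊗ ℝ` with `w₀`-coordinate `X_{ij}` and all other coordinates `0`; the middle row and column vanish) such that replacing the `w₀`-component of `G : Π_w U(Φ₂)_w` by `Y` changes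
`↑↑ι_∞(eA⁻¹ G, b)` by `Λ(↑↑Y − ↑↑G_{w₀})`. [cite: Rogawski1990, §4.8 Case (a) p. 53] [cite: BorelJacquet1979, §4.1] -/
theorem exists_clm_ambient_endoEmbArch_update :
    ∃ Λ : Matrix (Fin 2) (Fin 2) ℂ →L[ℝ] Matrix (Fin 3) (Fin 3) (mixedSpace L), Injective Λ ∧
      ∀ (G : ∀ w : {w : InfinitePlace L // IsComplex w}, ↥(archLocal L 2 Φ₂[L] w)) (Y : ↥(archLocal L 2 Φ₂[L] w₀)) (b : 𝔹[L]),
        (((endoEmbArch L ((archPiEquivCM 2 L Φ₂[L]).symm (Function.update G w₀ Y), b)).val : GL (Fin 3) (mixedSpace L)) : Matrix (Fin 3) (Fin 3) (mixedSpace L)) =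
          (((endoEmbArch L ((archPiEquivCM 2 L Φ₂[L]).symm G, b)).val : GL (Fin 3) (mixedSpace L)) : Matrix (Fin 3) (Fin 3) (mixedSpace L)) +
            Λ ((((Y : ↥(archLocal L 2 Φ₂[L] w₀)) : GL (Fin 2) ℂ) : Matrix (Fin 2) (Fin 2) ℂ) - (((G w₀ : ↥(archLocal L 2 Φ₂[L] w₀)) : GL (Fin 2) ℂ) : Matrix (Fin 2) (Fin 2) ℂ)) := by
  classical
  -- the coordinate embedding `ι₀ : ℂ →ₗ[ℝ] L ⊗ ℝ` at `w₀`
  let ι₀ : ℂ →ₗ[ℝ] mixedSpace L := (LinearMap.inr ℝ ({v : InfinitePlace L // IsReal v} → ℝ) ({w : InfinitePlace L // IsComplex w} → ℂ)).comp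
    (LinearMap.single ℝ (fun _ : {w : InfinitePlace L // IsComplex w} => ℂ) w₀)
  have hι₀ : ∀ (x : ℂ) (w : {w : InfinitePlace L // IsComplex w}), (ι₀ x).2 w = Pi.single (M := fun _ : {w : InfinitePlace L // IsComplex w} => ℂ) w₀ x w :=
    fun x w => rfl
  -- the block embedding `A ↦ (A 0; 0 0)` on `Fin 2 ⊕ Fin 1`, linear
  let B : Matrix (Fin 2) (Fin 2) (mixedSpace L) →ₗ[ℝ] Matrix (Fin 2 ⊕ Fin 1) (Fin 2 ⊕ Fin 1) (mixedSpace L) :=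
    { toFun := fun A => Matrix.fromBlocks A 0 0 (0 : Matrix (Fin 1) (Fin 1) (mixedSpace L))
      map_add' := fun A A' => by
        show Matrix.fromBlocks (A + A') 0 0 (0 : Matrix (Fin 1) (Fin 1) (mixedSpace L)) = Matrix.fromBlocks A 0 0 0 + Matrix.fromBlocks A' 0 0 0
        rw [Matrix.fromBlocks_add, add_zero, add_zero, add_zero]
      map_smul' := fun a A => by
        show Matrix.fromBlocks (a • A) 0 0 (0 : Matrix (Fin 1) (Fin 1) (mixedSpace L)) = a • Matrix.fromBlocks A 0 0 0
        rw [Matrix.fromBlocks_smul, smul_zero, smul_zero, smul_zero] }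
  let Λ₀ : Matrix (Fin 2) (Fin 2) ℂ →ₗ[ℝ] Matrix (Fin 3) (Fin 3) (mixedSpace L) :=
    ((Matrix.reindexLinearEquiv ℝ (mixedSpace L) endoPerm endoPerm).toLinearMap.comp B).comp ι₀.mapMatrix
  have hΛ₀ : ∀ X : Matrix (Fin 2) (Fin 2) ℂ, Λ₀ X = Matrix.reindex endoPerm endoPerm (Matrix.fromBlocks (X.map ι₀) 0 0 (0 : Matrix (Fin 1) (Fin 1) (mixedSpace L))) :=
    fun X => rfl
  refine ⟨LinearMap.toContinuousLinearMap Λ₀, fun X X' hXX' => ?_, fun G Y b => ?_⟩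
  · -- injectivity: the `w₀`-coordinates of the `(e_a, e_b)` entries recover `X`
    have h : Λ₀ X = Λ₀ X' := hXX'
    rw [hΛ₀, hΛ₀] at h
    have h2 := (Matrix.fromBlocks_inj.1 ((Matrix.reindex endoPerm endoPerm).injective h)).1
    ext a c
    have h3 := congrArg (fun M : Matrix (Fin 2) (Fin 2) (mixedSpace L) => (M a c).2 w₀) h2
    simpa [Matrix.map_apply, hι₀] using h3
  · -- the update identity: both sides are `reindex endoPerm endoPerm (fromBlocks · 0 0 ↑b)`; compare the `2 × 2` blocks coordinatewise
    have hev : ∀ (G' : ∀ w : {w : InfinitePlace L // IsComplex w}, ↥(archLocal L 2 Φ₂[L] w)) (w : {w : InfinitePlace L // IsComplex w}) (a c : Fin 2),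
        (((((archPiEquivCM 2 L Φ₂[L]).symm G' : 𝔸[L]).val : GL (Fin 2) (mixedSpace L)) : Matrix (Fin 2) (Fin 2) (mixedSpace L)) a c).2 w =
          (((G' w : ↥(archLocal L 2 Φ₂[L] w)) : GL (Fin 2) ℂ) : Matrix (Fin 2) (Fin 2) ℂ) a c := by
      intro G' w a c
      have h := coe_archPiEquivCM_apply (N := 2) L Φ₂[L] ((archPiEquivCM 2 L Φ₂[L]).symm G') w
      rw [ContinuousMulEquiv.apply_symm_apply] at h
      rw [h, Matrix.GeneralLinearGroup.map_apply]
      rfl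
    have hblock : ((((archPiEquivCM 2 L Φ₂[L]).symm (Function.update G w₀ Y) : 𝔸[L]).val : GL (Fin 2) (mixedSpace L)) : Matrix (Fin 2) (Fin 2) (mixedSpace L)) =
        ((((archPiEquivCM 2 L Φ₂[L]).symm G : 𝔸[L]).val : GL (Fin 2) (mixedSpace L)) : Matrix (Fin 2) (Fin 2) (mixedSpace L)) +
          ((((Y : ↥(archLocal L 2 Φ₂[L] w₀)) : GL (Fin 2) ℂ) : Matrix (Fin 2) (Fin 2) ℂ) - (((G w₀ : ↥(archLocal L 2 Φ₂[L] w₀)) : GL (Fin 2) ℂ) : Matrix (Fin 2) (Fin 2) ℂ)).map ι₀ := by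
      refine Matrix.ext fun a c => ?_
      refine mixedSpace_ext (↥(maximalRealSubfield L)) L (IsCMField.complexConj L) (IsCMField.complexConj_ne_one L) (complexConj_smul_infinitePlace L) fun w => ?_
      rw [Matrix.add_apply, Prod.snd_add, Pi.add_apply, hev, hev, Matrix.map_apply, hι₀]
      by_cases hw : w = w₀
      · subst hw
        rw [Function.update_self, Pi.single_eq_same, Matrix.sub_apply, add_sub_cancel]
      · rw [Function.update_of_ne hw, Pi.single_eq_of_ne hw, add_zero]
    show _ = _ + Λ₀ _
    rw [hΛ₀, coe_endoEmbArch, coe_endoEmbArch, coe_endoGL, coe_endoGL]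
    show Matrix.reindex endoPerm endoPerm (Matrix.fromBlocks
        ((((archPiEquivCM 2 L Φ₂[L]).symm (Function.update G w₀ Y) : 𝔸[L]).val : GL (Fin 2) (mixedSpace L)) : Matrix (Fin 2) (Fin 2) (mixedSpace L)) 0 0
        (((b : 𝔹[L]).val : GL (Fin 1) (mixedSpace L)) : Matrix (Fin 1) (Fin 1) (mixedSpace L))) =
      Matrix.reindex endoPerm endoPerm (Matrix.fromBlocks
        ((((archPiEquivCM 2 L Φ₂[L]).symm G : 𝔸[L]).val : GL (Fin 2) (mixedSpace L)) : Matrix (Fin 2) (Fin 2) (mixedSpace L)) 0 0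
        (((b : 𝔹[L]).val : GL (Fin 1) (mixedSpace L)) : Matrix (Fin 1) (Fin 1) (mixedSpace L))) +
      Matrix.reindex endoPerm endoPerm (Matrix.fromBlocks
        (((((Y : ↥(archLocal L 2 Φ₂[L] w₀)) : GL (Fin 2) ℂ) : Matrix (Fin 2) (Fin 2) ℂ) - (((G w₀ : ↥(archLocal L 2 Φ₂[L] w₀)) : GL (Fin 2) ℂ) : Matrix (Fin 2) (Fin 2) ℂ)).map ι₀) 0 0 0)
    rw [hblock]
    simp only [Matrix.reindex_apply]
    refine Matrix.ext fun i j => ?_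
    rw [Matrix.add_apply, Matrix.submatrix_apply, Matrix.submatrix_apply, Matrix.submatrix_apply, ← Matrix.add_apply, Matrix.fromBlocks_add, add_zero, add_zero,
      add_zero]

end Update

/-! ## §2 The jointly smooth family `(q, Y) ↦ Θ(q + Λ Y)` and its uniform compact `Y`-support over a compact set of parameters -/

section Family

variable {Q : Type*} [NormedAddCommGroup Q] [NormedSpace ℝ Q] {M : Type*} [NormedAddCommGroup M] [NormedSpace ℝ M] {E : Type*} [NormedAddCommGroup E] [NormedSpace ℝ E]

/-- `(q, Y) ↦ Θ(q + Λ Y)` is `C^∞` for `Θ` `C^∞` and `Λ` continuous linear (the `Φ` of ★ (α4-S3)). [cite: HormanderALPDO1, §1.1] -/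
theorem contDiff_comp_fst_add_clm_snd {Θ : Q → E} (hΘ : ContDiff ℝ ∞ Θ) (Λ : M →L[ℝ] Q) : ContDiff ℝ ∞ fun q : Q × M => Θ (q.1 + Λ q.2) :=
  hΘ.comp (contDiff_fst.add (Λ.contDiff.comp contDiff_snd))

omit [NormedSpace ℝ E] in
/-- **UNIFORM COMPACT `Y`-SUPPORT**: for `Θ` with compact support, `Λ` an INJECTIVE continuous linear map from a finite-dimensional space and a compact `C ⊆ Q` there is ONE compact `K` with
`Θ(q + Λ Y) ≠ 0 → Y ∈ K` for all `q ∈ C` (`Λ` is a closed embedding; `K = Λ⁻¹(supp Θ − C)`) — the clause `h0` of ★ (α4-S3). [cite: HormanderALPDO1, §1.1] -/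
theorem exists_isCompact_forall_apply_add_ne_zero_imp_mem [FiniteDimensional ℝ M] {Θ : Q → E} (hΘc : HasCompactSupport Θ) (Λ : M →L[ℝ] Q) (hΛ : Injective Λ)
    {C : Set Q} (hC : IsCompact C) : ∃ K : Set M, IsCompact K ∧ ∀ q ∈ C, ∀ Y, Θ (q + Λ Y) ≠ 0 → Y ∈ K := by
  haveI : CompleteSpace M := FiniteDimensional.complete ℝ M
  obtain ⟨κ, -, hanti⟩ := (Λ : M →ₗ[ℝ] Q).injective_iff_antilipschitz.1 hΛ
  have hce : IsClosedEmbedding Λ := AntilipschitzWith.isClosedEmbedding (f := (Λ : M → Q)) hanti Λ.uniformContinuous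
  refine ⟨Λ ⁻¹' ((fun p : Q × Q => p.1 - p.2) '' (tsupport Θ ×ˢ C)), hce.isCompact_preimage ((hΘc.prod hC).image (continuous_fst.sub continuous_snd)), fun q hq Y hY => ?_⟩
  refine ⟨(q + Λ Y, q), ⟨subset_tsupport _ hY, hq⟩, ?_⟩
  show q + Λ Y - q = Λ Y
  abel

end Family

end Literature.NumberTheory.Rogawski1990

end
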